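import Summits.BirchSwinnertonDyer.Rank1Residual.Additive.RamifiedSevenGenusKummerLayerIndex
import HarnessLib

/-!
# `𝒞₇` genus road (crux `EllipticUnitValueSevenOfGZK`, K7r), row K2C-12 = (B2′) KUMMER NON-VANISHING, File TWa:
# TORSION LIFTS AND THEIR AGREEMENT WITH TRANSPORTED REPRESENTATIVES ON EVERY LAYER `F′ₙ`

Cell bsd-cm, seat bsd-cm-k-ty1 g32; pen START packet `bsd-cm-plan/g38/START-kty1-g32.md` §2 (L5b/L6 inputs); ruling D1082.  Sequel of
`RamifiedSevenGenusKummerLayerIndex.lean` (same setting: `e : K̄ →+* ℚ̄` an identification of algebraic closures, `c : Γ_K →* Γ_ℚ` a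
transport of `e` (`e (σ z) = c σ (e z)`), `Hₙ = layerFixing F e n`, `Uₙ` the layers of the restricted CYCLOTOMIC `ℤ₇`-extension, (A1) `s² = −7`
in `K`).
* §1 transport of root-of-unity exponents through `c` (`transport_smul_eq_pow`), the range criterion «`g` fixes `e(s)` ⇒ `g ∈ c(Γ_K)`»
  (`K = ℚ(s)`), and ★ `exists_smul_eq_pow_of_jacobiSym_eq_one`: `Γ_K` contains an element acting on `ζ′₀` (`e ζ′₀ = ζsys 0`) as any
  prescribed `a` prime to `7|D|` with `(a|7) = 1` (the source of the `hinv`-witness of L4b: `a ≡ 2 (7)`, `a ≡ 1 (|D|)`).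
* §2 `exists_torsionLift_eta`: E1's torsion lift `υ ∈ Υ` of `a` WITHOUT the `γ₀`-factor, with `η₁(υ) = χ_D(a)ω(a)⁵`.
* §3 ★★ `forall_smul_eq_transport_smul`: for `σ ∈ Uₙ` in the `H₀`-coset of `τ`, `τ ζ′₀ = ζ′₀^a`, and `υ` the torsion lift of `a`:
  `υ` and `c σ` AGREE ON `F′ₙ` (on `F₀ ⊆ ℚ(μ_{|D|})` through `τ`; on `μ_{7^{n+1}}` because `σ ∈ Uₙ` has a `6`-torsion exponent there,
  File A2b); `exists_quotientMap` (pure group theory: `U/Hₙ ≃ Γ/H₀` through representatives in `U`, from `Hₙ ≤ H₀`, `U ⊓ H₀ ≤ Hₙ`).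
HONEST LABEL: Galois bookkeeping; theorems only (no definition, no named fact, no instance, no sorry); nothing closes;
(B2′) NOT proved here; stmt-BirchSwinnertonDyer-19945 OPEN; BSD claimed for no curve.

## References
* K. Kato, Astérisque 295 (2004), §15.5 (p. 253), 15.14 (p. 264). [Kato2004Asterisque]
* T. Tsuji, J. Number Theory 78 (1999), §3 (pp. 5–6), §4 (p. 12). [Tsuji1999]
* L. C. Washington, *Introduction to Cyclotomic Fields* (1997), Thm. 2.5, §13.1. [Washington1997]
* K. Ireland, M. Rosen, *A Classical Introduction to Modern Number Theory* (1990), Ch. 6 §3. [IrelandRosen1990]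
* S. Lang, *Cyclotomic Fields I–II* (1990), Ch. 10 §1 (PDF p. 167). [Lang1990]
-/

noncomputable section

open scoped NumberField
open Field
open Literature.NumberTheory.IwasawaTheory
open Literature.NumberTheory.GaloisRepresentations Literature.NumberTheory.GaloisRepresentations.LocalWeilDatum
open Literature.NumberTheory.EllipticCurves

namespace Summit.BirchSwinnertonDyer.Rank1Residual.Additive.GenusSeven

namespace GenusFrame

variable (F : GenusFrame) {Kcm : Type} [Field Kcm] [NumberField Kcm]
  (e : AlgebraicClosure Kcm →+* AlgebraicClosure ℚ) {c : absoluteGaloisGroup Kcm →* absoluteGaloisGroup ℚ}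

/-! ## §1 Transport of exponents; the range criterion; elements of `Γ_K` with prescribed exponent -/

omit [NumberField Kcm] in
/-- An automorphism of `K̄` acting on a primitive `N`-th root of unity as the `a`-th power acts so on every `k`-th root of unity,
`k ∣ N`. [cite: Washington1997, Thm. 2.5] -/
theorem smul_eq_pow_of_smul_eq_pow_of_dvd {N : ℕ} [NeZero N] {ζ₀' : AlgebraicClosure Kcm} (hζ₀' : IsPrimitiveRoot ζ₀' N)
    {σ : absoluteGaloisGroup Kcm} {a : ℕ} (hσ : σ • ζ₀' = ζ₀' ^ a) {k : ℕ} (hk : k ∣ N) (x : AlgebraicClosure Kcm)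
    (hx : x ^ k = 1) : σ • x = x ^ a := by
  have hxN : x ^ N = 1 := by
    obtain ⟨m, rfl⟩ := hk
    rw [pow_mul, hx, one_pow]
  obtain ⟨i, -, rfl⟩ := hζ₀'.eq_pow_of_pow_eq_one hxN
  rw [smul_pow', hσ, ← pow_mul, ← pow_mul, mul_comm]

omit [NumberField Kcm] in
/-- **Transport of exponents**: if `σ ∈ Γ_K` acts on a primitive `N`-th root of unity of `K̄` as the `a`-th power, then `c σ`
acts on the `k`-th roots of unity of `ℚ̄` (`k ∣ N`) as the `a`-th power (`e` is a bijection onto `ℚ̄`).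
[cite: Washington1997, Thm. 2.5] [cite: Kato2004Asterisque, §15.14 (p. 264)] -/
theorem transport_smul_eq_pow (hc : ∀ (σ : absoluteGaloisGroup Kcm) (z : AlgebraicClosure Kcm), e (σ • z) = c σ • e z)
    (hbij : Function.Bijective e) {N : ℕ} [NeZero N] {ζ₀' : AlgebraicClosure Kcm} (hζ₀' : IsPrimitiveRoot ζ₀' N)
    {σ : absoluteGaloisGroup Kcm} {a : ℕ} (hσ : σ • ζ₀' = ζ₀' ^ a) {k : ℕ} (hk : k ∣ N) (x : AlgebraicClosure ℚ)
    (hx : x ^ k = 1) : c σ • x = x ^ a := by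
  obtain ⟨x', rfl⟩ := hbij.2 x
  have hx' : x' ^ k = 1 := hbij.1 (by rw [map_pow, hx, map_one])
  rw [← hc, smul_eq_pow_of_smul_eq_pow_of_dvd hζ₀' hσ hk x' hx', map_pow]

/-- **The range criterion**: an automorphism of `ℚ̄` fixing `e(s)` fixes `e(K)` pointwise (`K = ℚ(s)`: `s ∉ ℚ`, `[K:ℚ] = 2`),
hence lies in `c(Γ_K)` (range description of the transport). [cite: Kato2004Asterisque, §15.14 (p. 264, «K ⊂ ℚ(ζ_N)»)] -/
theorem mem_range_of_smul_apply_algebraMap_eq (h2 : Module.finrank ℚ Kcm = 2) {s : Kcm} (hs : s ^ 2 = -7)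
    (hrange : ∀ g : absoluteGaloisGroup ℚ, g ∈ c.range ↔
      ∀ x : Kcm, g • e (algebraMap Kcm (AlgebraicClosure Kcm) x) = e (algebraMap Kcm (AlgebraicClosure Kcm) x))
    {g : absoluteGaloisGroup ℚ}
    (hg : g • e (algebraMap Kcm (AlgebraicClosure Kcm) s) = e (algebraMap Kcm (AlgebraicClosure Kcm) s)) : g ∈ c.range := by
  rw [hrange]
  -- the equaliser of `g ∘ ψ` and `ψ`, `ψ = e ∘ (K → K̄)` as a `ℚ`-algebra map
  let ψ : Kcm →ₐ[ℚ] AlgebraicClosure ℚ := (e.comp (algebraMap Kcm (AlgebraicClosure Kcm))).toRatAlgHom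
  let A : Subalgebra ℚ Kcm := AlgHom.equalizer
    ((absoluteGaloisGroup.toAlgEquiv ℚ g : AlgebraicClosure ℚ ≃ₐ[ℚ] AlgebraicClosure ℚ).toAlgHom.comp ψ) ψ
  have hmem : ∀ x : Kcm, x ∈ A ↔
      g • e (algebraMap Kcm (AlgebraicClosure Kcm) x) = e (algebraMap Kcm (AlgebraicClosure Kcm) x) := fun x ↦ by
    rw [AlgHom.mem_equalizer, absoluteGaloisGroup.smul_def]; rfl
  -- `ℚ(s) = K`
  have hint : IsIntegral ℚ s := Algebra.IsIntegral.isIntegral s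
  have hnot : s ∉ (algebraMap ℚ Kcm).range := by
    rintro ⟨q, hq⟩
    have h1 : (algebraMap ℚ Kcm) (q ^ 2) = (algebraMap ℚ Kcm) (-7) := by rw [map_pow, hq, hs]; simp
    have h2' : q ^ 2 = -7 := (algebraMap ℚ Kcm).injective h1
    nlinarith [sq_nonneg q]
  have h2le : 2 ≤ (minpoly ℚ s).natDegree := (minpoly.two_le_natDegree_iff hint).mpr hnot
  have hle2 : (minpoly ℚ s).natDegree ≤ 2 := h2 ▸ minpoly.natDegree_le s
  have htop : IntermediateField.adjoin ℚ {s} = (⊤ : IntermediateField ℚ Kcm) :=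
    IntermediateField.eq_of_le_of_finrank_eq le_top
      (by rw [IntermediateField.adjoin.finrank hint, IntermediateField.finrank_top', h2]; omega)
  have hA : Algebra.adjoin ℚ {s} ≤ A := Algebra.adjoin_le (Set.singleton_subset_iff.mpr ((hmem s).mpr hg))
  have hAtop : (⊤ : Subalgebra ℚ Kcm) ≤ A := by
    rw [← IntermediateField.top_toSubalgebra, ← htop, IntermediateField.adjoin_simple_toSubalgebra_of_isAlgebraic hint.isAlgebraic]
    exact hA
  intro x
  exact (hmem x).mp (hAtop (Algebra.mem_top (x := x)))

/-- ★ **`Γ_K` realises every exponent `a` with `(a|7) = 1`** on `ζ′₀` (`e ζ′₀ = ζsys 0`, a primitive `7|D|`-th root of unity of `K̄`):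
an automorphism `g` of `ℚ̄` acting on `μ_{7|D|}` as the `a`-th power multiplies the Gauss sum `G` (`G² = −7`) by `(a|7) = 1`, hence fixes
`e(s) = ±G`, hence is `c σ` for some `σ ∈ Γ_K`, and then `σ ζ′₀ = ζ′₀^a`. [cite: IrelandRosen1990, Ch. 6 §3] [cite: Washington1997, Thm. 2.5] -/
theorem exists_smul_eq_pow_of_jacobiSym_eq_one
    (hc : ∀ (σ : absoluteGaloisGroup Kcm) (z : AlgebraicClosure Kcm), e (σ • z) = c σ • e z)
    (hbij : Function.Bijective e) (h2 : Module.finrank ℚ Kcm = 2) {s : Kcm} (hs : s ^ 2 = -7)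
    (hrange : ∀ g : absoluteGaloisGroup ℚ, g ∈ c.range ↔
      ∀ x : Kcm, g • e (algebraMap Kcm (AlgebraicClosure Kcm) x) = e (algebraMap Kcm (AlgebraicClosure Kcm) x))
    {ζ₀' : AlgebraicClosure Kcm} (heζ₀ : e ζ₀' = F.ζsys 0) {a : ℕ} (ha : a.Coprime (7 * F.d)) (hja : jacobiSym a 7 = 1) :
    ∃ σ : absoluteGaloisGroup Kcm, σ • ζ₀' = ζ₀' ^ a := by
  haveI : NeZero (7 * F.d) := ⟨mul_ne_zero (by norm_num) F.d_ne_zero⟩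
  obtain ⟨g, hg⟩ := exists_rat_smul_eq_pow ha
  obtain ⟨G, -, hG2, hG0, hGal⟩ := exists_gauss_seven
  have hg7 : ∀ ζ : AlgebraicClosure ℚ, ζ ^ 7 = 1 → g • ζ = ζ ^ a := fun ζ hζ ↦
    hg ζ (by rw [pow_mul, hζ, one_pow])
  have hgG : g • G = G := by rw [hGal g a hg7, hja, Int.cast_one, one_mul]
  have hgs : g • e (algebraMap Kcm (AlgebraicClosure Kcm) s) = e (algebraMap Kcm (AlgebraicClosure Kcm) s) := by
    rcases apply_algebraMap_eq_or e hs hG2 with h | h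
    · rw [h, hgG]
    · rw [h, smul_neg, hgG]
  obtain ⟨σ, rfl⟩ := mem_range_of_smul_apply_algebraMap_eq e h2 hs hrange hgs
  refine ⟨σ, hbij.1 ?_⟩
  have h0 : F.ζsys 0 ^ (7 * F.d) = 1 := by rw [mul_comm]; exact F.isPrimitiveRoot_ζsys_zero.pow_eq_one
  rw [hc, map_pow, heζ₀, hg _ h0]

/-! ## §2 Torsion lifts with their `η₁`-reading (E1 without the `γ₀`-factor) -/

/-- **The torsion lift of `a` and its `η₁`-value**: for `a` prime to `7|D|` there is `υ ∈ Υ` with `χ₇(υ) = ω(a)`, acting on `μ_{|D|}`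
and on `μ₇` as the `a`-th power, and `η₁(υ) = χ_D(a)·ω(a)⁵` (the frame's Dirichlet reading at `ζsys 0`).
[cite: Tsuji1999, §3 (p. 6) and §4 (p. 12, «χ = φω^i»)] [cite: Washington1997, Thm. 2.5] [cite: Lang1990, Ch. 10 §1 (PDF p. 167)] -/
theorem exists_torsionLift_eta {a : ℕ} (ha : a.Coprime (7 * F.d)) :
    ∃ υ : torsionCyclotomicSubgroup 7,
      haveI : Fact (Nat.Prime 7) := ⟨Nat.prime_seven⟩
      GaloisRep.cyclotomicCharacter ℚ 7 (υ : absoluteGaloisGroup ℚ) =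
          MulChar.toUnitHom F.ω (ZMod.unitOfCoprime a (Nat.Coprime.coprime_mul_right_right ha)) ∧
        (∀ ζ : AlgebraicClosure ℚ, ζ ^ F.d = 1 → (υ : absoluteGaloisGroup ℚ) • ζ = ζ ^ a) ∧
        (∀ ζ : AlgebraicClosure ℚ, ζ ^ 7 = 1 → (υ : absoluteGaloisGroup ℚ) • ζ = ζ ^ a) ∧
        ((F.η₁ υ : ℤ_[7]ˣ) : ℤ_[7]) = F.χD (a : ZMod F.d) * F.ω (a : ZMod 7) ^ 5 := by
  haveI : Fact (Nat.Prime 7) := ⟨Nat.prime_seven⟩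
  haveI : NeZero F.d := ⟨F.d_ne_zero⟩
  haveI : NeZero (7 : ℕ) := ⟨by norm_num⟩
  have ha7 : a.Coprime 7 := Nat.Coprime.coprime_mul_right_right ha
  obtain ⟨υ, hχ, hd⟩ := F.exists_torsionLift ha
  have h6 : a ^ 6 ≡ 1 [MOD 7 ^ (0 + 1)] := by
    have h := Nat.ModEq.pow_totient ha7
    rw [Nat.totient_prime Nat.prime_seven] at h
    simpa using h
  have h7 : ∀ ζ : AlgebraicClosure ℚ, ζ ^ 7 = 1 → (υ : absoluteGaloisGroup ℚ) • ζ = ζ ^ a := fun ζ hζ ↦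
    F.smul_eq_pow_of_cyclotomicCharacter_eq_omega' (n := 0) ha7 h6 hχ ζ (by rwa [zero_add, pow_one])
  have hζ0 : (υ : absoluteGaloisGroup ℚ) • F.ζsys 0 = F.ζsys 0 ^ a :=
    smul_eq_pow_of_coprime F.d_coprime_seven _ a hd h7 _ F.isPrimitiveRoot_ζsys_zero.pow_eq_one
  exact ⟨υ, hχ, hd, h7, F.η₁_reading υ a (by rw [← absoluteGaloisGroup.smul_def]; exact hζ0)⟩

/-! ## §3 ★★ Agreement on `F′ₙ` of the torsion lift with the transported representative -/

section Agreement

variable (h2 : Module.finrank ℚ Kcm = 2) (K : ZpExtension ℚ 7)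

/-- ★★ **AGREEMENT ON `F′ₙ`.**  Let `σ ∈ Uₙ` lie in the `H₀`-coset of `τ` (`τ⁻¹σ ∈ H₀`), `τ ζ′₀ = ζ′₀^a` for a primitive `7|D|`-th root
of unity `ζ′₀` of `K̄` (`a` prime to `7|D|`), and `υ ∈ Γ_ℚ` with `χ₇(υ) = ω(a)` acting on `μ_{|D|}` as the `a`-th power.  Then
`υ y = (c σ) y` for every `y ∈ F′ₙ = F₀(μ_{7^{n+1}})`: on `F₀ ⊆ ℚ(μ_{|D|})` because `c σ = c τ · c(τ⁻¹σ)`, `c(H₀)` fixes `F′₀ ⊇ F₀` and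
`c τ` acts on `μ_{|D|}` by `a`; on `μ_{7^{n+1}}` because `σ ∈ Uₙ` acts there by an `a′` with `a′⁶ ≡ 1 (7^{n+1})` (A2b, `K_cyc`
cyclotomic) and `a′ ≡ a (7)` (`τ⁻¹σ` fixes `μ₇(K̄)`), so the torsion `υ` acts by `a′` too (Hensel, A2b).
[cite: Tsuji1999, §3 (pp. 5–6, «Gal(K_n/ℚ) ≅ G × Gal(K_n/K)»)] [cite: Washington1997, Thm. 2.5 and §13.1] [cite: Kato2004Asterisque, 15.14 (p. 264)] -/
theorem forall_smul_eq_transport_smul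
    (hc : ∀ (σ : absoluteGaloisGroup Kcm) (z : AlgebraicClosure Kcm), e (σ • z) = c σ • e z)
    (hbij : Function.Bijective e) (hK : K.IsCyclotomic) (n : ℕ) {σ τ : absoluteGaloisGroup Kcm}
    (hσU : σ ∈ (K.restrictOfFinrankEqTwo (by decide) Kcm h2).layerSubgroup n) (hτσ : τ⁻¹ * σ ∈ layerFixing F e 0)
    {ζ₀' : AlgebraicClosure Kcm} (hζ₀' : IsPrimitiveRoot ζ₀' (7 * F.d)) {a : ℕ} (ha : a.Coprime (7 * F.d))
    (hτ : τ • ζ₀' = ζ₀' ^ a) {υ : absoluteGaloisGroup ℚ}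
    (hυ : haveI : Fact (Nat.Prime 7) := ⟨Nat.prime_seven⟩
      GaloisRep.cyclotomicCharacter ℚ 7 υ = MulChar.toUnitHom F.ω (ZMod.unitOfCoprime a (Nat.Coprime.coprime_mul_right_right ha)))
    (hυd : ∀ ζ : AlgebraicClosure ℚ, ζ ^ F.d = 1 → υ • ζ = ζ ^ a)
    (y : AlgebraicClosure ℚ) (hy : y ∈ F.layer n) : υ • y = c σ • y := by
  haveI : Fact (Nat.Prime 7) := ⟨Nat.prime_seven⟩
  haveI : NeZero F.d := ⟨F.d_ne_zero⟩
  haveI : NeZero (7 * F.d) := ⟨mul_ne_zero (by norm_num) F.d_ne_zero⟩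
  haveI : NeZero (7 ^ (n + 1)) := ⟨pow_ne_zero _ (by norm_num)⟩
  haveI : NeZero (7 ^ (n + 1) * F.d) := ⟨mul_ne_zero (pow_ne_zero _ (by norm_num)) F.d_ne_zero⟩
  haveI : NeZero (7 : ℕ) := ⟨by norm_num⟩
  have ha7 : a.Coprime 7 := Nat.Coprime.coprime_mul_right_right ha
  -- `σ = τ · h` with `h = τ⁻¹σ ∈ H₀`
  have hστ : σ = τ * (τ⁻¹ * σ) := by rw [mul_inv_cancel_left]
  -- a primitive `7^{n+1}`-th root of unity `ξ` of `K̄`, the exponent `a'` of `σ` on it: `a'⁶ ≡ 1 (7^{n+1})`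
  obtain ⟨ζn, -, hζn⟩ := F.exists_apply_eq_ζsys e n
  have hξ : IsPrimitiveRoot (ζn ^ F.d) (7 ^ (n + 1)) := hζn.pow (NeZero.pos _) (mul_comm _ _)
  obtain ⟨a', ha', hσξ⟩ := exists_smul_eq_pow_of_isPrimitiveRoot hξ σ
  have ha'7 : a'.Coprime 7 := (Nat.coprime_pow_right_iff (Nat.succ_pos n) _ _).mp ha'
  have h6 : a' ^ 6 ≡ 1 [MOD 7 ^ (n + 1)] := exists_modEq_pow_six_of_mem_layerSubgroup h2 K hK n hσU hξ hσξ
  -- `a ≡ a' (mod 7)`: compare on the primitive 7th root `ζ₇′ = ξ^{7^n}` of `K̄`, fixed by `τ⁻¹σ ∈ H₀` (`e ζ₇′ ∈ μ₇ ⊂ F′₀`)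
  have hζ7 : IsPrimitiveRoot ((ζn ^ F.d) ^ 7 ^ n) 7 := hξ.pow (NeZero.pos _) (pow_succ 7 n)
  have hζ7one : ((ζn ^ F.d) ^ 7 ^ n) ^ 7 = 1 := hζ7.pow_eq_one
  have hmem0 : e ((ζn ^ F.d) ^ 7 ^ n) ∈ F.layer 0 := by
    apply mem_cyclotomicLayer_of_pow_eq_one F.F₀ 7 0
    rw [zero_add, pow_one, ← map_pow, hζ7one, map_one]
  have hfix : (τ⁻¹ * σ) • (ζn ^ F.d) ^ 7 ^ n = (ζn ^ F.d) ^ 7 ^ n := (F.mem_layerFixing_iff e 0 _).mp hτσ _ hmem0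
  have h1 : σ • (ζn ^ F.d) ^ 7 ^ n = ((ζn ^ F.d) ^ 7 ^ n) ^ a := by
    rw [hστ, mul_smul, hfix]
    exact smul_eq_pow_of_smul_eq_pow_of_dvd hζ₀' hτ (Dvd.intro _ rfl) _ hζ7one
  have h1' : σ • (ζn ^ F.d) ^ 7 ^ n = ((ζn ^ F.d) ^ 7 ^ n) ^ a' :=
    smul_eq_pow_of_smul_eq_pow_of_dvd hξ hσξ (Dvd.intro_left _ (pow_succ 7 n).symm) _ hζ7one
  have haa' : a ≡ a' [MOD 7] := modEq_of_pow_eq_pow hζ7 (h1.symm.trans h1')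
  have hunits : ZMod.unitOfCoprime a' ha'7 = ZMod.unitOfCoprime a ha7 := Units.ext (by
    rw [ZMod.coe_unitOfCoprime, ZMod.coe_unitOfCoprime]
    exact ((ZMod.natCast_eq_natCast_iff _ _ _).mpr haa').symm)
  have hυ' : GaloisRep.cyclotomicCharacter ℚ 7 υ = MulChar.toUnitHom F.ω (ZMod.unitOfCoprime a' ha'7) := by
    rw [hunits]; exact hυ
  -- on `μ_{7^{n+1}} ⊂ ℚ̄`: both act by `a'`
  have hT : ∀ x ∈ {x : AlgebraicClosure ℚ | x ^ 7 ^ (n + 1) = 1}, υ • x = c σ • x := fun x hx ↦ by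
    rw [F.smul_eq_pow_of_cyclotomicCharacter_eq_omega' ha'7 h6 hυ' x hx,
      transport_smul_eq_pow e hc hbij hξ hσξ (dvd_refl _) x hx]
  -- on `F₀`: `c σ = c τ · c h`, `c h` fixes `F′₀ ⊇ F₀`, and `c τ` agrees with `υ` on `ℚ(μ_{|D|}) ⊇ F₀`
  have hτυ : ∀ x : AlgebraicClosure ℚ, x ∈ (⊥ : IntermediateField ℚ (AlgebraicClosure ℚ)) ⊔
      IntermediateField.adjoin ℚ {x : AlgebraicClosure ℚ | x ^ F.D.natAbs = 1} → υ • x = c τ • x :=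
    forall_smul_eq_of_le_sup_adjoin (S := (∅ : Set (AlgebraicClosure ℚ))) (by simp) (fun x hx ↦ absurd hx (Set.notMem_empty x))
      fun x hx ↦ by rw [hυd x hx, transport_smul_eq_pow e hc hbij hζ₀' hτ (Dvd.intro_left 7 rfl) x hx]
  have hS : ∀ x ∈ (F.F₀ : Set (AlgebraicClosure ℚ)), υ • x = c σ • x := by
    intro x hx
    have hx0 : x ∈ F.layer 0 := le_cyclotomicLayer F.F₀ 7 0 hx
    have hhx : c (τ⁻¹ * σ) • x = x :=
      (mem_galFixing_iff ℚ).mp ((F.mem_layerFixing_iff_mem_galFixing e hc hbij 0 _).mp hτσ) x hx0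
    rw [hστ, map_mul, mul_smul, hhx]
    exact hτυ x ((le_sup_right : IntermediateField.adjoin ℚ {x : AlgebraicClosure ℚ | x ^ F.D.natAbs = 1} ≤
      ⊥ ⊔ IntermediateField.adjoin ℚ {x : AlgebraicClosure ℚ | x ^ F.D.natAbs = 1}) (F.F₀_le hx))
  exact forall_smul_eq_of_le_sup_adjoin (IntermediateField.subset_adjoin ℚ (F.F₀ : Set (AlgebraicClosure ℚ))) hS hT y
    (by rw [← cyclotomicLayer_def]; exact hy)

/-- **The bijection `U/Hₙ ≃ Γ/H₀` through representatives in `U`** (pure group theory; the road: `U = Uₙ`, `Hₙ ≤ H₀`, (U*)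
`U ⊓ H₀ ≤ Hₙ`, `U ⊔ H₀ = Γ_K`): for representatives `t δ ∈ U` of the classes `δ ∈ Γ/H₀`, the map `U/Hₙ → Γ/H₀`, `u ↦ uH₀`, is a
well-defined bijection for which `x ↦ t(π x)` is a system of representatives of `U/Hₙ` — ONE family of representatives indexes the
twisted norms of all levels. [cite: Kato2004Asterisque, 15.14 (p. 264)] [cite: Tsuji1999, §3 (p. 6)] -/
theorem exists_quotientMap {Γ : Type*} [Group Γ] {U H₀ Hn : Subgroup Γ} (hle : Hn ≤ H₀) (hinf : U ⊓ H₀ ≤ Hn)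
    {t : Γ ⧸ H₀ → Γ} (htU : ∀ δ, t δ ∈ U) (ht : ∀ δ, (t δ : Γ ⧸ H₀) = δ) :
    ∃ π : U ⧸ Hn.subgroupOf U → Γ ⧸ H₀, Function.Bijective π ∧
      ∀ x, ((⟨t (π x), htU (π x)⟩ : U) : U ⧸ Hn.subgroupOf U) = x := by
  have hUH : ∀ u v : U, ((u : Γ) : Γ ⧸ H₀) = (v : Γ) → (u : U ⧸ Hn.subgroupOf U) = v := by
    intro u v h
    rw [QuotientGroup.eq] at h ⊢
    rw [Subgroup.mem_subgroupOf, Subgroup.coe_mul, Subgroup.coe_inv]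
    exact hinf ⟨(u⁻¹ * v).2, h⟩
  -- the map
  let π : U ⧸ Hn.subgroupOf U → Γ ⧸ H₀ :=
    Quotient.lift (fun u : U ↦ ((u : Γ) : Γ ⧸ H₀)) fun u v huv ↦ by
      have huv' := QuotientGroup.leftRel_apply.mp huv
      rw [Subgroup.mem_subgroupOf, Subgroup.coe_mul, Subgroup.coe_inv] at huv'
      exact QuotientGroup.eq.mpr (hle huv')
  have hπ : ∀ u : U, π (u : U ⧸ Hn.subgroupOf U) = ((u : Γ) : Γ ⧸ H₀) := fun u ↦ rfl
  have hsec : ∀ x, ((⟨t (π x), htU (π x)⟩ : U) : U ⧸ Hn.subgroupOf U) = x := by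
    intro x
    induction x using QuotientGroup.induction_on with
    | H u => exact hUH _ _ (by rw [hπ, Subgroup.coe_mk, ht])
  refine ⟨π, ⟨fun x y hxy ↦ ?_, fun δ ↦ ⟨((⟨t δ, htU δ⟩ : U) : U ⧸ Hn.subgroupOf U), by rw [hπ, Subgroup.coe_mk, ht]⟩⟩, hsec⟩
  induction x using QuotientGroup.induction_on with
  | H u =>
    induction y using QuotientGroup.induction_on with
    | H v => exact hUH u v (by rwa [hπ, hπ] at hxy)

end Agreement

end GenusFrame

end Summit.BirchSwinnertonDyer.Rank1Residual.Additive.GenusSeven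

end
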